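import Literature.NumberTheory.Sieve.BombieriFriedlanderIwaniecDispersionS3
import Literature.NumberTheory.Sieve.ShiuBrunTitchmarshProofs
import HarnessLib

/-!
# Bombieri–Friedlander–Iwaniec 1986, §5 for Theorem 1: `𝒮₂ = f̂(0) X + ℛ₂`

Topic `Literature/NumberTheory/Sieve`.  Third file of the formalisation of the provable part of the
proof of Theorem 1 of E. Bombieri, J. B. Friedlander, H. Iwaniec, *Primes in arithmetic
progressions to large moduli*, Acta Math. 156 (1986), 203–251, after
`…DispersionSmoothing` (§3) and `…DispersionS3` (§4).  This is §5 (pp. 216–218), "Evaluation of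
`𝒮₂`", for BFI's weight `f = BFI.bump M Y`, in the form needed for THEOREM 1.  Everything here is
PROVED; no named facts are introduced.

## The simplification available in the range of Theorem 1

BFI treat `𝒮₂` for all of Theorems 1–4 at once: after Möbius inversion of `(m, q₂) = 1` (5.1) and
Poisson summation modulo `ν q₁ r` (Lemma 2), the frequencies `0 < |h| ≤ H₀ = x^ε QR/M` lead to
incomplete Kloosterman sums, bounded by Weil's estimate (5.3).  In the range of Theorem 1 one has
`N²Q < x^{1−2ε}` and `R < N x^{−ε}`, hence `QR < M x^{−3ε}` and `H₀ < 1`: there are NO such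
frequencies, and the Poisson formula is only needed with its tail.  Accordingly this file proves
`𝒮₂ = f̂(0) X + ℛ₂` with `ℛ₂` controlled by (i) a hypothesis `T` bounding the Poisson tails of the
moduli `ν q₁ r`, `ν ∣ q₂`, `ν ≤ V` (made superpolynomially small in the assembly by
`ν q₁ r ≤ V·4QR ≤ M x^{−ε}`), and (ii) the trivial count for `ν > V` (BFI (5.2)).  Weil's bound is
not used.

## Contents

* Totient identities: `BFI.totient_eq_mul_prod_real` (Euler's product over `ℝ`),
  `BFI.totient_mul_mul_totient_gcd_mul` (`φ(q₁q₂r) φ(gr) = g φ(q₁r) φ(q₂r)`, `g = (q₁,q₂)`; the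
  identity behind (7.5)), **`BFI.sum_divisors_filter_coprime_moebius_div`**
  (`∑_{ν∣q,(ν,d)=1} μ(ν)/ν = φ(qd)/(qφ(d))`, the singular series of §5, via
  `…_eq_prod` = `∏_{p∣q, p∤d}(1 − 1/p)` and `BFI.totient_mul_div_eq_prod`).
* `BFI.sum_filter_coprime_eq_sum_divisors_real` (Möbius inversion, real sums),
  `BFI.crtClass` / `BFI.natCast_eq_crtClass_iff` (the class modulo `νd` of the multiples of `ν` in a
  class modulo `d`), `BFI.sum_filter_dvd_class_eq_classSum`, the trivial counts
  `BFI.sum_mRange_filter_bump_le_card`, `BFI.sum_filter_dvd_class_le`.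
* **`BFI.norm_sum_coprime_class_sub_le`** — the inner sum of `𝒮₂`:
  `‖∑_{m∈mRange,(m,q)=1,m≡c (d)} f(m) − α̂₀ φ(qd)/(dqφ(d))‖ ≤ τ(q) (T + (3M+3Y)/(Vd) + 1)` for a
  reduced class `c`, `V ≥ 1`.
* `BFI.dS2_eq`, `BFI.invClass` (`a n̄ mod d`), `BFI.mA2_bump_eq`
  (`A₂ = [(q₁q₂r,a)=1][(n₁,q₁r)=1] ∑_{(m,q₂)=1, m≡a n̄₁ (q₁r)} f(m)`), `BFI.norm_mA2_term_sub_le`,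
  `BFI.mainX_eq_sum₄`, and **`BFI.norm_dS2_sub_mainX_le`**:
  `‖𝒮₂ − α̂₀ X‖ ≤ ∑_{r∼R}∑_{q₁,q₂∼Q} |γ_{q₁}γ_{q₂}| (∑_{n∼N}|β_n|)² τ(q₂)/φ(q₂r) (T + (3M+3Y)/(Vq₁r) + 1)`.

## Faithfulness

The main term is EXACTLY BFI's `f̂(0) X` (same `X = BFI.mainX` as for `𝒮₃`), as asserted on
p. 217 ("Having done this the resulting total sum proves to be `f̂(0)X`").  The error is kept
explicit and un-averaged; its averaging (`≪ ‖β‖²(x^{1−2ε'}R⁻¹ + NQ)ℒ^B`, admissible by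
`NQR < x^{1−3ε}`) and the choice `V = x^{ε'}` belong to the assembly of Theorem 1.  For Theorems
2–4 (larger `QR`) the oscillatory terms and (5.3) would be needed; they are not treated here.

## References

* E. Bombieri, J. B. Friedlander, H. Iwaniec, Acta Math. 156 (1986), 203–251, §5 pp. 216–218,
  (5.1)–(5.4); §7 (7.5) p. 223. [BombieriFriedlanderIwaniecActa1986]
-/

noncomputable section

open Finset Real
open scoped ArithmeticFunction.sigma

namespace Literature.NumberTheory.Sieve

namespace BFI

/-! ### Two totient identities -/

/-- Euler's product formula over `ℝ`: `φ(n) = n ∏_{p ∣ n} (1 − 1/p)`. [folklore] -/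
theorem totient_eq_mul_prod_real (n : ℕ) :
    (Nat.totient n : ℝ) = n * ∏ p ∈ n.primeFactors, (1 - (p : ℝ)⁻¹) := by
  have h := congrArg (fun x : ℚ => (x : ℝ)) (Nat.totient_eq_mul_prod_factors n)
  push_cast at h
  exact h

/-- For `q₁, q₂, r ≥ 1` with `g = (q₁, q₂)`: `φ(q₁q₂r) φ(g r) = g φ(q₁r) φ(q₂r)` (prime by prime;
here from Mathlib's `φ(gcd(a,b)) φ(ab) = φ(a) φ(b) gcd(a,b)` at `(q₁r, q₂r)` and `(r, q₁q₂r)`).  This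
is the identity behind BFI (7.5), `𝒳₀ = X + O(…)` ("extending the summation over all `q₀`").
[folklore] -/
theorem totient_mul_mul_totient_gcd_mul {q₁ q₂ r : ℕ} (hr : 0 < r) :
    Nat.totient (q₁ * q₂ * r) * Nat.totient (Nat.gcd q₁ q₂ * r) =
      Nat.gcd q₁ q₂ * Nat.totient (q₁ * r) * Nat.totient (q₂ * r) := by
  have h1 := Nat.totient_gcd_mul_totient_mul (q₁ * r) (q₂ * r)
  rw [Nat.gcd_mul_right] at h1
  have h2 := Nat.totient_gcd_mul_totient_mul r (q₁ * q₂ * r)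
  rw [Nat.gcd_eq_left (dvd_mul_left r _)] at h2
  have hφr : 0 < Nat.totient r := Nat.totient_pos.2 hr
  have h3 : Nat.totient (r * (q₁ * q₂ * r)) = Nat.totient (q₁ * q₂ * r) * r :=
    Nat.eq_of_mul_eq_mul_left hφr (h2.trans (mul_assoc _ _ _))
  have e : q₁ * r * (q₂ * r) = r * (q₁ * q₂ * r) := by ring
  rw [e, h3] at h1
  have h4 : (Nat.totient (Nat.gcd q₁ q₂ * r) * Nat.totient (q₁ * q₂ * r)) * r =
      (Nat.totient (q₁ * r) * Nat.totient (q₂ * r) * Nat.gcd q₁ q₂) * r := by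
    calc _ = Nat.totient (Nat.gcd q₁ q₂ * r) * (Nat.totient (q₁ * q₂ * r) * r) := by ring
      _ = _ := by rw [h1]; ring
  have h5 := Nat.eq_of_mul_eq_mul_right hr h4
  calc Nat.totient (q₁ * q₂ * r) * Nat.totient (Nat.gcd q₁ q₂ * r)
      = Nat.totient (Nat.gcd q₁ q₂ * r) * Nat.totient (q₁ * q₂ * r) := mul_comm _ _
    _ = Nat.totient (q₁ * r) * Nat.totient (q₂ * r) * Nat.gcd q₁ q₂ := h5
    _ = _ := by ring

/-- `∑_{ν ∣ q, (ν, d) = 1} μ(ν)/ν = ∏_{p ∣ q, p ∤ d} (1 − 1/p)` for `q, d ≥ 1`. [folklore] -/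
theorem sum_divisors_filter_coprime_moebius_div_eq_prod {q d : ℕ} (hq : 0 < q) (hd : 0 < d) :
    ∑ ν ∈ q.divisors.filter (fun ν => ν.Coprime d), (ArithmeticFunction.moebius ν : ℝ) / ν =
      ∏ p ∈ q.primeFactors \ d.primeFactors, (1 - (p : ℝ)⁻¹) := by
  classical
  have h1 : ∑ ν ∈ q.divisors.filter (fun ν => ν.Coprime d), (ArithmeticFunction.moebius ν : ℝ) / ν =
      ∑ ν ∈ q.divisors.filter Squarefree,
        (if ν.Coprime d then (ArithmeticFunction.moebius ν : ℝ) / ν else 0) := by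
    rw [Finset.sum_filter, Finset.sum_filter]
    refine Finset.sum_congr rfl fun ν _ => ?_
    by_cases hsq : Squarefree ν
    · rw [if_pos hsq]
    · rw [if_neg hsq, ArithmeticFunction.moebius_eq_zero_of_not_squarefree hsq]
      simp
  rw [h1, Nat.sum_divisors_filter_squarefree hq.ne']
  have hP : (UniqueFactorizationMonoid.normalizedFactors q).toFinset = q.primeFactors := by
    rw [Nat.factors_eq]
    rfl
  rw [hP]
  have hT : ∀ T ∈ q.primeFactors.powerset,
      (if (T.val.prod).Coprime d then (ArithmeticFunction.moebius T.val.prod : ℝ) / T.val.prod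
        else 0) = ∏ p ∈ T, (if p ∣ d then (0 : ℝ) else -(p : ℝ)⁻¹) := by
    intro T hT
    have hTsub : T ⊆ q.primeFactors := Finset.mem_powerset.1 hT
    have hprime : ∀ p ∈ T, p.Prime := fun p hp => Nat.prime_of_mem_primeFactors (hTsub hp)
    have hprod : T.val.prod = ∏ p ∈ T, p := by
      rw [Finset.prod_eq_multiset_prod, Multiset.map_id']
    rw [hprod]
    by_cases hex : ∃ p ∈ T, p ∣ d
    · obtain ⟨p, hpT, hpd⟩ := hex
      rw [Finset.prod_eq_zero (f := fun p => if p ∣ d then (0 : ℝ) else -(p : ℝ)⁻¹) hpT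
        (if_pos hpd), if_neg]
      intro hcop
      have hp := Nat.coprime_prod_left_iff.1 hcop p hpT
      exact (Nat.Prime.coprime_iff_not_dvd (hprime p hpT)).1 hp hpd
    · simp only [not_exists, not_and] at hex
      rw [if_pos (Nat.coprime_prod_left_iff.2 fun p hp =>
        (Nat.Prime.coprime_iff_not_dvd (hprime p hp)).2 (hex p hp))]
      rw [ArithmeticFunction.IsMultiplicative.map_prod_of_prime
        ArithmeticFunction.isMultiplicative_moebius T hprime]
      push_cast
      rw [← Finset.prod_div_distrib]
      refine Finset.prod_congr rfl fun p hp => ?_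
      rw [if_neg (hex p hp), ArithmeticFunction.moebius_apply_prime (hprime p hp)]
      push_cast
      rw [neg_div, one_div]
  rw [Finset.sum_congr rfl hT, ← Finset.prod_one_add]
  rw [← Finset.prod_filter_mul_prod_filter_not q.primeFactors (fun p => p ∣ d)]
  rw [Finset.prod_congr rfl (fun p hp => by rw [if_pos (Finset.mem_filter.1 hp).2, add_zero]),
    Finset.prod_const_one, one_mul]
  have hset : q.primeFactors.filter (fun p => ¬p ∣ d) = q.primeFactors \ d.primeFactors := by
    ext p
    simp only [Finset.mem_filter, Finset.mem_sdiff, Nat.mem_primeFactors, ne_eq]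
    constructor
    · rintro ⟨hpq, hpd⟩
      exact ⟨hpq, fun h => hpd h.2.1⟩
    · rintro ⟨hpq, hpd⟩
      exact ⟨hpq, fun h => hpd ⟨hpq.1, h, hd.ne'⟩⟩
  rw [hset]
  refine Finset.prod_congr rfl fun p hp => ?_
  obtain ⟨hpq, hpd⟩ := Finset.mem_sdiff.1 hp
  have hnd : ¬p ∣ d := fun h =>
    hpd (Nat.mem_primeFactors.2 ⟨Nat.prime_of_mem_primeFactors hpq, h, hd.ne'⟩)
  rw [if_neg hnd]
  ring

/-- `φ(qd)/(q φ(d)) = ∏_{p ∣ q, p ∤ d} (1 − 1/p)` for `q, d ≥ 1`. [folklore] -/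
theorem totient_mul_div_eq_prod {q d : ℕ} (hq : 0 < q) (hd : 0 < d) :
    (Nat.totient (q * d) : ℝ) / (q * (Nat.totient d : ℝ)) =
      ∏ p ∈ q.primeFactors \ d.primeFactors, (1 - (p : ℝ)⁻¹) := by
  have hfac : ∀ p ∈ d.primeFactors, (1 - (p : ℝ)⁻¹) ≠ 0 := by
    intro p hp
    have hp2 : (2 : ℝ) ≤ p := by exact_mod_cast (Nat.prime_of_mem_primeFactors hp).two_le
    have : (p : ℝ)⁻¹ ≤ 1 / 2 := by rw [inv_le_comm₀ (by linarith) (by norm_num)]; linarith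
    linarith
  have hne : ∏ p ∈ d.primeFactors, (1 - (p : ℝ)⁻¹) ≠ 0 := Finset.prod_ne_zero_iff.2 hfac
  have hdφ : (0 : ℝ) < Nat.totient d := by exact_mod_cast Nat.totient_pos.2 hd
  rw [totient_eq_mul_prod_real (q * d), totient_eq_mul_prod_real d,
    Nat.primeFactors_mul hq.ne' hd.ne',
    ← Finset.prod_sdiff (Finset.subset_union_right : d.primeFactors ⊆ q.primeFactors ∪ d.primeFactors),
    Finset.union_sdiff_right]
  have hq0 : (q : ℝ) ≠ 0 := by exact_mod_cast hq.ne'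
  have hd0 : (d : ℝ) ≠ 0 := by exact_mod_cast hd.ne'
  have key : ∀ A B : ℝ, B ≠ 0 → (q : ℝ) * d * (A * B) / (q * (d * B)) = A := by
    intro A B hB
    field_simp
  push_cast
  exact key _ _ hne

/-- **`∑_{ν ∣ q, (ν, d) = 1} μ(ν)/ν = φ(qd)/(q φ(d))`** for `q, d ≥ 1`: the density of the integers
coprime to `q` among the integers of a reduced class modulo `d` (BFI §5, p. 217: summing the main
terms `f̂(0)/(ν q₁ r)` over `ν ∣ q₂`, `(ν, q₁r) = 1` "the resulting total sum proves to be
`f̂(0) X`"). [folklore] -/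
theorem sum_divisors_filter_coprime_moebius_div {q d : ℕ} (hq : 0 < q) (hd : 0 < d) :
    ∑ ν ∈ q.divisors.filter (fun ν => ν.Coprime d), (ArithmeticFunction.moebius ν : ℝ) / ν =
      (Nat.totient (q * d) : ℝ) / (q * (Nat.totient d : ℝ)) := by
  rw [sum_divisors_filter_coprime_moebius_div_eq_prod hq hd, totient_mul_div_eq_prod hq hd]


/-! ### Möbius inversion of a coprimality condition (real sums) -/

/-- `∑_{m ∈ S, (m,k)=1} f(m) = ∑_{d ∣ k} μ(d) ∑_{m ∈ S, d ∣ m} f(m)` for `k ≥ 1`, real-valued `f`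
(the tree's complex version `BFI.sum_filter_coprime_eq_sum_divisors`, transported). [folklore] -/
theorem sum_filter_coprime_eq_sum_divisors_real (S : Finset ℕ) (f : ℕ → ℝ) {k : ℕ} (hk : 0 < k) :
    ∑ m ∈ S.filter (fun m => m.Coprime k), f m =
      ∑ d ∈ k.divisors, (ArithmeticFunction.moebius d : ℝ) *
        ∑ m ∈ S.filter (fun m => d ∣ m), f m := by
  have h := sum_filter_coprime_eq_sum_divisors S (fun m => (f m : ℂ)) hk
  have h' : ((∑ m ∈ S.filter (fun m => m.Coprime k), f m : ℝ) : ℂ) =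
      ((∑ d ∈ k.divisors, (ArithmeticFunction.moebius d : ℝ) *
        ∑ m ∈ S.filter (fun m => d ∣ m), f m : ℝ) : ℂ) := by
    push_cast
    exact h
  exact_mod_cast h'

/-! ### The class modulo `νd` of the multiples of `ν` in a class modulo `d` -/

/-- For `(ν, d) = 1` and a class `c (mod d)`: the class modulo `νd` which is `0 (mod ν)` and
`c (mod d)` (Chinese remainder theorem). [folklore] -/
def crtClass {ν d : ℕ} (h : ν.Coprime d) (c : ZMod d) : ZMod (ν * d) :=
  (ZMod.chineseRemainder h).symm (0, c)

/-- `m ≡ crtClass (mod νd) ↔ ν ∣ m ∧ m ≡ c (mod d)`. [folklore] -/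
theorem natCast_eq_crtClass_iff {ν d : ℕ} (h : ν.Coprime d) (c : ZMod d) (m : ℕ) :
    (m : ZMod (ν * d)) = crtClass h c ↔ ν ∣ m ∧ (m : ZMod d) = c := by
  unfold crtClass
  have he : ZMod.chineseRemainder h (m : ZMod (ν * d)) = ((m : ZMod ν), (m : ZMod d)) := by
    rw [map_natCast]
    exact Prod.ext (Prod.fst_natCast m) (Prod.snd_natCast m)
  constructor
  · intro hm
    have h2 := congrArg (ZMod.chineseRemainder h) hm
    rw [RingEquiv.apply_symm_apply, he, Prod.mk.injEq, ZMod.natCast_eq_zero_iff] at h2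
    exact h2
  · rintro ⟨h1, h2⟩
    rw [← (ZMod.chineseRemainder h).symm_apply_apply (m : ZMod (ν * d)), he,
      (ZMod.natCast_eq_zero_iff m ν).2 h1, h2]

/-- The multiples of `ν` in the class `c (mod d)` (inside `mRange`) are the class `crtClass (mod νd)`;
their weighted count is `BFI.classSum M Y (νd) crtClass`. [folklore] -/
theorem sum_filter_dvd_class_eq_classSum (M Y : ℝ) {ν d : ℕ} (h : ν.Coprime d) (c : ZMod d) :
    ∑ m ∈ ((mRange M Y).filter (fun m : ℕ => (m : ZMod d) = c)).filter (fun m => ν ∣ m),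
        bump M Y m = classSum M Y (ν * d) (crtClass h c) := by
  unfold classSum
  rw [Finset.filter_filter]
  refine Finset.sum_congr (Finset.filter_congr fun m _ => ?_) fun _ _ => rfl
  rw [natCast_eq_crtClass_iff]
  tauto

/-! ### Trivial bounds for sums of the weight over a class -/

/-- `∑_{m ∈ mRange, P(m)} f(m) ≤ #{1 ≤ m ≤ 2M+Y : P(m)}` (`0 ≤ f ≤ 1`, `f(0) = 0`). [folklore] -/
theorem sum_mRange_filter_bump_le_card {M Y : ℝ} (hY : 0 < Y) (hYM : Y ≤ M) (P : ℕ → Prop)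
    [DecidablePred P] :
    ∑ m ∈ (mRange M Y).filter P, bump M Y m ≤ (#((Finset.Icc 1 ⌊2 * M + Y⌋₊).filter P) : ℝ) := by
  have hM : 0 ≤ M := hY.le.trans hYM
  have h0 : bump M Y ((0 : ℕ) : ℝ) = 0 := bump_eq_zero_of_le hY hM (by push_cast; linarith)
  rw [← Finset.sum_erase (f := fun m : ℕ => bump M Y m) ((mRange M Y).filter P) h0]
  calc ∑ m ∈ ((mRange M Y).filter P).erase 0, bump M Y m
      ≤ ∑ m ∈ ((mRange M Y).filter P).erase 0, (1 : ℝ) :=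
        Finset.sum_le_sum fun m _ => (bump_mem_Icc hY hM _).2
    _ = #(((mRange M Y).filter P).erase 0) := by simp
    _ ≤ #((Finset.Icc 1 ⌊2 * M + Y⌋₊).filter P) := by
        exact_mod_cast Finset.card_le_card fun m hm => by
          rw [Finset.mem_erase, Finset.mem_filter, mem_mRange] at hm
          rw [Finset.mem_filter, Finset.mem_Icc]
          exact ⟨⟨Nat.one_le_iff_ne_zero.2 hm.1, hm.2.1⟩, hm.2.2⟩

/-- The multiples of `ν` in a class modulo `d` among `1 ≤ m ≤ 2M + Y` ((ν,d)=1): at most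
`(2M+Y)/(νd) + 1` of them, hence `0 ≤ ∑_{m ∈ mRange, ν ∣ m, m ≡ c (d)} f(m) ≤ (2M+Y)/(νd) + 1`.
[folklore] -/
theorem sum_filter_dvd_class_le {M Y : ℝ} (hY : 0 < Y) (hYM : Y ≤ M) {ν d : ℕ} (hν : 0 < ν)
    (hd : 0 < d) (h : ν.Coprime d) (c : ZMod d) :
    0 ≤ ∑ m ∈ ((mRange M Y).filter (fun m : ℕ => (m : ZMod d) = c)).filter (fun m => ν ∣ m),
        bump M Y m ∧
    ∑ m ∈ ((mRange M Y).filter (fun m : ℕ => (m : ZMod d) = c)).filter (fun m => ν ∣ m),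
        bump M Y m ≤ (2 * M + Y) / (ν * d) + 1 := by
  have hM : 0 ≤ M := hY.le.trans hYM
  refine ⟨Finset.sum_nonneg fun m _ => (bump_mem_Icc hY hM _).1, ?_⟩
  rw [Finset.filter_filter]
  refine (sum_mRange_filter_bump_le_card hY hYM _).trans ?_
  have hc := BFILemma3.card_filter_dvd_le ⌊2 * M + Y⌋₊ hν hd c
  rw [Nat.Coprime.lcm_eq_mul h] at hc
  have hL : (⌊2 * M + Y⌋₊ : ℝ) ≤ 2 * M + Y := Nat.floor_le (by linarith)
  calc (#((Finset.Icc 1 ⌊2 * M + Y⌋₊).filter (fun m : ℕ => (m : ZMod d) = c ∧ ν ∣ m)) : ℝ)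
      ≤ ((⌊2 * M + Y⌋₊ / (ν * d) + 1 : ℕ) : ℝ) := by exact_mod_cast hc
    _ = ((⌊2 * M + Y⌋₊ / (ν * d) : ℕ) : ℝ) + 1 := by push_cast; ring
    _ ≤ (⌊2 * M + Y⌋₊ : ℝ) / ((ν * d : ℕ) : ℝ) + 1 := by
        gcongr
        exact Nat.cast_div_le
    _ = (⌊2 * M + Y⌋₊ : ℝ) / (ν * d) + 1 := by push_cast; ring
    _ ≤ (2 * M + Y) / (ν * d) + 1 := by gcongr

/-! ### Lemma B: the `m`-sum of `𝒮₂` (congruence + coprimality) evaluated -/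

/-- **The smooth sum over a reduced class with a coprimality condition** (the inner sum of `𝒮₂`,
BFI §5 p. 216–217): for `0 < Y ≤ M`, `q, d ≥ 1`, a reduced class `c (mod d)`, a threshold
`V ≥ 1`, `j ≥ 2`, and a bound `T` for the Poisson tails `(νd)⁻¹ tailBound(Y, j, νd, 0)` of the
moduli `νd`, `ν ∣ q`, `ν ≤ V`:
`‖∑_{m ∈ mRange, (m,q)=1, m≡c (d)} f(m) − f̂(0) φ(qd)/(dqφ(d))‖ ≤ τ(q) (T + (3M+3Y)/(Vd) + 1)`.
Proof: Möbius inversion of `(m, q) = 1` (BFI (5.1)); the terms `ν ∣ q` with `(ν, d) > 1` are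
empty; for `(ν, d) = 1` the `m` run over one class modulo `νd`, counted by Poisson summation
(`BFI.norm_classSum_sub_le`, no oscillatory terms kept) when `ν ≤ V` and trivially when `ν > V`
(BFI: "The terms with `ν > x^{2ε}` contribute … (5.2) … Let `ν ≤ x^{2ε}`. By Lemma 2 …"), and the
completed singular series is `∑_{ν∣q,(ν,d)=1} μ(ν)/ν = φ(qd)/(qφ(d))`.
[cite: BombieriFriedlanderIwaniecActa1986, §5 (5.1)–(5.2) pp. 216–217] -/
theorem norm_sum_coprime_class_sub_le {M Y : ℝ} (hY : 0 < Y) (hYM : Y ≤ M) {q d : ℕ}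
    (hq : 0 < q) (hd : 0 < d) {c : ZMod d} (hc : IsUnit c) {V T : ℝ} (hV : 1 ≤ V) {j : ℕ}
    (hj : 2 ≤ j)
    (htail : ∀ ν ∈ q.divisors, (ν : ℝ) ≤ V →
      ((ν : ℝ) * d)⁻¹ * tailBound Y j (ν * d) 0 ≤ T) :
    ‖((∑ m ∈ (mRange M Y).filter (fun m : ℕ => m.Coprime q ∧ (m : ZMod d) = c),
          bump M Y m : ℝ) : ℂ) -
        alphaHat M Y * (((Nat.totient (q * d) : ℝ) / (d * (q * (Nat.totient d : ℝ))) : ℝ) : ℂ)‖ ≤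
      (σ 0 q : ℝ) * (T + (3 * M + 3 * Y) / (V * d) + 1) := by
  have hM : 0 ≤ M := hY.le.trans hYM
  haveI : NeZero d := ⟨hd.ne'⟩
  -- the inner sums `I ν`
  set S' : Finset ℕ := (mRange M Y).filter (fun m : ℕ => (m : ZMod d) = c) with hS'
  set I : ℕ → ℝ := fun ν => ∑ m ∈ S'.filter (fun m => ν ∣ m), bump M Y m with hI
  -- Möbius
  have hB : ∑ m ∈ (mRange M Y).filter (fun m : ℕ => m.Coprime q ∧ (m : ZMod d) = c), bump M Y m =
      ∑ ν ∈ q.divisors, (ArithmeticFunction.moebius ν : ℝ) * I ν := by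
    have e : (mRange M Y).filter (fun m : ℕ => m.Coprime q ∧ (m : ZMod d) = c) =
        S'.filter (fun m => m.Coprime q) := by
      rw [hS', Finset.filter_filter]
      exact Finset.filter_congr fun m _ => by tauto
    rw [e, sum_filter_coprime_eq_sum_divisors_real S' _ hq]
  -- (i) the terms with `(ν, d) > 1` vanish
  have hc' : (c.val).Coprime d := ZMod.val_coe_unit_coprime hc.unit
  have hvan : ∀ ν ∈ q.divisors, ¬ν.Coprime d → I ν = 0 := by
    intro ν _ hνd
    refine Finset.sum_eq_zero fun m hm => ?_
    exfalso
    rw [Finset.mem_filter, hS', Finset.mem_filter] at hm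
    obtain ⟨⟨_, hmc⟩, hνm⟩ := hm
    apply hνd
    -- `m ≡ c (d)` with `c` a unit: `(m, d) = 1`, and `ν ∣ m`
    have hmd : m.Coprime d := by
      have h1 : m % d = c.val % d := by
        rw [← ZMod.natCast_eq_natCast_iff', ZMod.natCast_zmod_val]
        exact hmc
      have h2 : Nat.gcd (c.val % d) d = 1 := by
        rw [← Nat.gcd_rec, Nat.gcd_comm]
        exact hc'
      show Nat.gcd m d = 1
      rw [Nat.gcd_comm, Nat.gcd_rec, h1]
      exact h2
    exact Nat.Coprime.coprime_dvd_left hνm hmd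
  -- (ii)+(iii) the small coprime `ν`: Poisson summation modulo `νd`
  have hsmall : ∀ ν ∈ q.divisors, ∀ hνd : ν.Coprime d, (ν : ℝ) ≤ V →
      ‖(I ν : ℂ) - alphaHat M Y * ((ν : ℂ) * d)⁻¹‖ ≤ T := by
    intro ν hν hνd hνV
    have hν0 := Nat.pos_of_mem_divisors hν
    have hk : 0 < ν * d := Nat.mul_pos hν0 hd
    have hIe : I ν = classSum M Y (ν * d) (crtClass hνd c) :=
      sum_filter_dvd_class_eq_classSum M Y hνd c
    have hP := norm_classSum_sub_le hY hYM hk (crtClass hνd c) 0 hj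
    have hosc : oscSum M Y (ν * d) (crtClass hνd c) 0 = 0 := by
      unfold oscSum
      simp
    rw [hosc, add_zero] at hP
    push_cast at hP
    calc ‖(I ν : ℂ) - alphaHat M Y * ((ν : ℂ) * d)⁻¹‖
        = ‖(classSum M Y (ν * d) (crtClass hνd c) : ℂ) - ((ν : ℂ) * d)⁻¹ * alphaHat M Y‖ := by
          rw [hIe, mul_comm (alphaHat M Y)]
      _ ≤ ((ν : ℝ) * d)⁻¹ * tailBound Y j (ν * d) 0 := hP
      _ ≤ T := htail ν hν hνV
  -- (iv) the large coprime `ν`: trivial count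
  have hα : ‖alphaHat M Y‖ ≤ M + 2 * Y := norm_fourier_bumpC_le hY hM 0
  have hlarge : ∀ ν ∈ q.divisors, ∀ hνd : ν.Coprime d, V < (ν : ℝ) →
      ‖(I ν : ℂ) - alphaHat M Y * ((ν : ℂ) * d)⁻¹‖ ≤ (3 * M + 3 * Y) / (V * d) + 1 := by
    intro ν hν hνd hνV
    have hν0 := Nat.pos_of_mem_divisors hν
    obtain ⟨hI0, hI1⟩ := sum_filter_dvd_class_le hY hYM hν0 hd hνd c
    have hνd_pos : (0 : ℝ) < ν * d := by positivity
    have hVd_pos : (0 : ℝ) < V * d := by positivity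
    have hn1 : ‖(I ν : ℂ)‖ ≤ (2 * M + Y) / (ν * d) + 1 := by
      rw [Complex.norm_real, Real.norm_eq_abs, abs_of_nonneg hI0]
      exact hI1
    have hn2 : ‖alphaHat M Y * ((ν : ℂ) * d)⁻¹‖ ≤ (M + 2 * Y) / (ν * d) := by
      have e : ((ν : ℂ) * d) = (((ν : ℝ) * d : ℝ) : ℂ) := by push_cast; ring
      rw [e, norm_mul, norm_inv, Complex.norm_real, Real.norm_eq_abs,
        abs_of_pos hνd_pos, ← div_eq_mul_inv]
      exact div_le_div_of_nonneg_right hα hνd_pos.le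
    have hmon : (3 * M + 3 * Y) / (ν * d) ≤ (3 * M + 3 * Y) / (V * d) :=
      div_le_div_of_nonneg_left (by positivity) hVd_pos
        (mul_le_mul_of_nonneg_right hνV.le (by positivity))
    calc ‖(I ν : ℂ) - alphaHat M Y * ((ν : ℂ) * d)⁻¹‖
        ≤ ‖(I ν : ℂ)‖ + ‖alphaHat M Y * ((ν : ℂ) * d)⁻¹‖ := norm_sub_le _ _
      _ ≤ ((2 * M + Y) / (ν * d) + 1) + (M + 2 * Y) / (ν * d) := add_le_add hn1 hn2
      _ = (3 * M + 3 * Y) / (ν * d) + 1 := by ring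
      _ ≤ (3 * M + 3 * Y) / (V * d) + 1 := by linarith
  -- the completed singular series
  have hMT : alphaHat M Y *
        (((Nat.totient (q * d) : ℝ) / (d * (q * (Nat.totient d : ℝ))) : ℝ) : ℂ) =
      ∑ ν ∈ q.divisors, (ArithmeticFunction.moebius ν : ℂ) *
        (if ν.Coprime d then alphaHat M Y * ((ν : ℂ) * d)⁻¹ else 0) := by
    have hsum := sum_divisors_filter_coprime_moebius_div hq hd
    rw [Finset.sum_filter] at hsum
    have hd0 : (d : ℝ) ≠ 0 := by exact_mod_cast hd.ne'
    have e : (Nat.totient (q * d) : ℝ) / (d * (q * (Nat.totient d : ℝ))) =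
        (d : ℝ)⁻¹ * ∑ ν ∈ q.divisors,
          (if ν.Coprime d then (ArithmeticFunction.moebius ν : ℝ) / ν else 0) := by
      rw [hsum]
      ring
    rw [e]
    push_cast
    rw [Finset.mul_sum, Finset.mul_sum]
    refine Finset.sum_congr rfl fun ν hν => ?_
    have hν0 : (ν : ℂ) ≠ 0 := by exact_mod_cast (Nat.pos_of_mem_divisors hν).ne'
    have hd0' : (d : ℂ) ≠ 0 := by exact_mod_cast hd.ne'
    split_ifs
    · push_cast
      field_simp
    · simp
  -- `T ≥ 0` (from the divisor `ν = 1`)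
  have hT0 : 0 ≤ T := by
    have h1 := htail 1 (Nat.one_mem_divisors.2 hq.ne') (by simpa using hV)
    exact le_trans (mul_nonneg (by positivity) (tailBound_nonneg hY _ _ _)) h1
  have hK0 : 0 ≤ T + (3 * M + 3 * Y) / (V * d) + 1 := by positivity
  -- assemble
  rw [hB, hMT]
  push_cast
  rw [← Finset.sum_sub_distrib]
  refine (norm_sum_le _ _).trans ?_
  calc ∑ ν ∈ q.divisors, ‖(ArithmeticFunction.moebius ν : ℂ) * (I ν : ℂ) -
          (ArithmeticFunction.moebius ν : ℂ) *
            (if ν.Coprime d then alphaHat M Y * ((ν : ℂ) * d)⁻¹ else 0)‖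
      ≤ ∑ ν ∈ q.divisors, (T + (3 * M + 3 * Y) / (V * d) + 1) := by
        refine Finset.sum_le_sum fun ν hν => ?_
        by_cases hνd : ν.Coprime d
        · rw [if_pos hνd, ← mul_sub, norm_mul]
          have hμ : ‖(ArithmeticFunction.moebius ν : ℂ)‖ ≤ 1 := by
            rw [Complex.norm_intCast]
            exact_mod_cast ArithmeticFunction.abs_moebius_le_one
          have hIν : ‖(I ν : ℂ) - alphaHat M Y * ((ν : ℂ) * d)⁻¹‖ ≤
              T + (3 * M + 3 * Y) / (V * d) + 1 := by
            rcases le_or_gt (ν : ℝ) V with hνV | hνV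
            · have := hsmall ν hν hνd hνV
              have : (0 : ℝ) ≤ (3 * M + 3 * Y) / (V * d) := by positivity
              linarith
            · have := hlarge ν hν hνd hνV
              linarith
          calc ‖(ArithmeticFunction.moebius ν : ℂ)‖ *
                ‖(I ν : ℂ) - alphaHat M Y * ((ν : ℂ) * d)⁻¹‖
              ≤ 1 * (T + (3 * M + 3 * Y) / (V * d) + 1) :=
                mul_le_mul hμ hIν (norm_nonneg _) zero_le_one
            _ = _ := one_mul _
        · rw [if_neg hνd, hvan ν hν hνd]
          simp only [Complex.ofReal_zero, mul_zero, sub_zero, norm_zero]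
          exact hK0
    _ = (σ 0 q : ℝ) * (T + (3 * M + 3 * Y) / (V * d) + 1) := by
        rw [Finset.sum_const, nsmul_eq_mul, ArithmeticFunction.sigma_zero_apply]


/-! ### `𝒮₂ = f̂(0) X + ℛ₂` (BFI (5.4), in the range of Theorem 1) -/

/-- `𝒮₂` with the `n₂`-sum factored:
`𝒮₂ = ∑_{r,q₁,q₂} γ_{q₁}γ_{q₂} (∑_{(n,q₂r)=1} β_n/φ(q₂r)) ∑_{n₁} β_{n₁} A₂(r,q₁,q₂,n₁)`. [folklore] -/
theorem dS2_eq (a : ℤ) (S : Finset ℕ) (N Q R : ℝ) (w β γ : ℕ → ℝ) :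
    dS2 a S N Q R w β γ = ∑ r ∈ dyadic R, ∑ q₁ ∈ dyadic Q, ∑ q₂ ∈ dyadic Q,
      γ q₁ * γ q₂ * (cSum N β (q₂ * r) / (Nat.totient (q₂ * r) : ℝ)) *
        ∑ n₁ ∈ dyadic N, β n₁ * mA2 a S w r q₁ q₂ n₁ := by
  unfold dS2
  refine Finset.sum_congr rfl fun r _ => Finset.sum_congr rfl fun q₁ _ =>
    Finset.sum_congr rfl fun q₂ _ => ?_
  rw [← sum_mul_copW, Finset.mul_sum]
  refine Finset.sum_congr rfl fun n₁ _ => ?_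
  rw [Finset.mul_sum, Finset.sum_mul]
  refine Finset.sum_congr rfl fun n₂ _ => ?_
  ring

/-- The class `a n̄ (mod d)`. [folklore] -/
def invClass (a : ℤ) (d n : ℕ) : ZMod d := (a : ZMod d) * ((n : ZMod d))⁻¹

/-- `a n̄` is a reduced class when `(d, a) = 1` and `(n, d) = 1`. [folklore] -/
theorem isUnit_invClass {a : ℤ} {d n : ℕ} (hda : IsCoprime (d : ℤ) a) (hn : n.Coprime d) :
    IsUnit (invClass a d n) := by
  unfold invClass
  refine IsUnit.mul ((ZMod.coe_int_isUnit_iff_isCoprime a d).2 hda) ?_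
  have hu : IsUnit (n : ZMod d) := (ZMod.isUnit_iff_coprime n d).2 hn
  exact IsUnit.of_mul_eq_one _ (ZMod.inv_mul_of_unit _ hu)

/-- For BFI's weight: `A₂(r,q₁,q₂,n₁) = [(q₁q₂r, a) = 1] [(n₁, q₁r) = 1] ∑_{(m,q₂)=1, m ≡ a n̄₁ (q₁r)} f(m)`.
[folklore] -/
theorem mA2_bump_eq (a : ℤ) (M Y : ℝ) (r q₁ q₂ n₁ : ℕ) :
    mA2 a (mRange M Y) (fun m => bump M Y m) r q₁ q₂ n₁ =
      if IsCoprime ((q₁ * q₂ * r : ℕ) : ℤ) a ∧ n₁.Coprime (q₁ * r) then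
        ∑ m ∈ (mRange M Y).filter
          (fun m : ℕ => m.Coprime q₂ ∧ (m : ZMod (q₁ * r)) = invClass a (q₁ * r) n₁), bump M Y m
      else 0 := by
  split_ifs with h
  · obtain ⟨hka, hn⟩ := h
    have hda : IsCoprime ((q₁ * r : ℕ) : ℤ) a := by
      apply IsCoprime.of_mul_left_left (y := (q₂ : ℤ))
      have e : ((q₁ * r : ℕ) : ℤ) * q₂ = ((q₁ * q₂ * r : ℕ) : ℤ) := by push_cast; ring
      rwa [e]
    unfold mA2
    rw [Finset.sum_filter]
    refine Finset.sum_congr rfl fun m _ => if_congr ?_ rfl rfl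
    rw [cop_iff, natCast_mul_eq_iff hn, invClass]
    constructor
    · rintro ⟨⟨_, hmk⟩, hm⟩
      refine ⟨Nat.Coprime.coprime_dvd_right ⟨q₁ * r, by ring⟩ hmk, hm⟩
    · rintro ⟨hm₂, hm⟩
      refine ⟨⟨hka, ?_⟩, hm⟩
      have hmd : m.Coprime (q₁ * r) := by
        rw [← ZMod.isUnit_iff_coprime, hm]
        exact isUnit_invClass hda hn
      have h1 : m.Coprime q₁ := Nat.Coprime.coprime_dvd_right ⟨r, rfl⟩ hmd
      have h2 : m.Coprime r := Nat.Coprime.coprime_dvd_right ⟨q₁, by ring⟩ hmd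
      exact Nat.Coprime.mul_right (Nat.Coprime.mul_right h1 hm₂) h2
  · by_cases hn : n₁.Coprime (q₁ * r)
    · have hka : ¬IsCoprime ((q₁ * q₂ * r : ℕ) : ℤ) a := fun h' => h ⟨h', hn⟩
      unfold mA2
      refine Finset.sum_eq_zero fun m _ => ?_
      rw [if_neg]
      rintro ⟨hc, _⟩
      exact hka ((cop_iff a r q₁ q₂ m).1 hc).1
    · exact mA2_eq_zero_of_not_coprime a _ _ q₂ hn

/-- One term of `𝒮₂ − f̂(0) X` (BFI §5 in the range of Theorem 1): for `r, q₁, q₂ ≥ 1` and every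
`n₁`, with `d = q₁r`, `k = q₁q₂r`, under the tail hypothesis of `BFI.norm_sum_coprime_class_sub_le`
for the moduli `ν d`, `ν ∣ q₂`, `ν ≤ V`:
`‖β_{n₁} A₂ − α̂₀ [(k,a)=1][(n₁,d)=1] β_{n₁} φ(k)/(k φ(d))‖ ≤ |β_{n₁}| τ(q₂) (T + (3M+3Y)/(Vd) + 1)`.
[cite: BombieriFriedlanderIwaniecActa1986, §5 pp. 216–217] -/
theorem norm_mA2_term_sub_le {M Y : ℝ} (hY : 0 < Y) (hYM : Y ≤ M) (a : ℤ) {r q₁ q₂ : ℕ}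
    (hr : 0 < r) (hq₁ : 0 < q₁) (hq₂ : 0 < q₂) (β : ℕ → ℝ) (n₁ : ℕ) {V T : ℝ} (hV : 1 ≤ V)
    {j : ℕ} (hj : 2 ≤ j)
    (htail : ∀ ν ∈ q₂.divisors, (ν : ℝ) ≤ V →
      ((ν : ℝ) * (q₁ * r : ℕ))⁻¹ * tailBound Y j (ν * (q₁ * r)) 0 ≤ T) :
    ‖((β n₁ * mA2 a (mRange M Y) (fun m => bump M Y m) r q₁ q₂ n₁ : ℝ) : ℂ) -
        alphaHat M Y * ((if IsCoprime ((q₁ * q₂ * r : ℕ) : ℤ) a ∧ n₁.Coprime (q₁ * r) then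
          β n₁ * ((Nat.totient (q₁ * q₂ * r) : ℝ) /
            ((q₁ * q₂ * r : ℕ) * (Nat.totient (q₁ * r) : ℝ))) else 0 : ℝ) : ℂ)‖ ≤
      |β n₁| * ((σ 0 q₂ : ℝ) * (T + (3 * M + 3 * Y) / (V * (q₁ * r : ℕ)) + 1)) := by
  have hM : 0 ≤ M := hY.le.trans hYM
  have hd : 0 < q₁ * r := Nat.mul_pos hq₁ hr
  rw [mA2_bump_eq]
  by_cases h : IsCoprime ((q₁ * q₂ * r : ℕ) : ℤ) a ∧ n₁.Coprime (q₁ * r)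
  · rw [if_pos h, if_pos h]
    obtain ⟨hka, hn⟩ := h
    have hda : IsCoprime ((q₁ * r : ℕ) : ℤ) a := by
      apply IsCoprime.of_mul_left_left (y := (q₂ : ℤ))
      have e : ((q₁ * r : ℕ) : ℤ) * q₂ = ((q₁ * q₂ * r : ℕ) : ℤ) := by push_cast; ring
      rwa [e]
    have hB := norm_sum_coprime_class_sub_le hY hYM hq₂ hd (isUnit_invClass hda hn) hV hj htail
    have ek : q₂ * (q₁ * r) = q₁ * q₂ * r := by ring
    rw [ek] at hB
    have e1 : ((Nat.totient (q₁ * q₂ * r) : ℝ) /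
        ((q₁ * q₂ * r : ℕ) * (Nat.totient (q₁ * r) : ℝ))) =
        (Nat.totient (q₁ * q₂ * r) : ℝ) / ((q₁ * r : ℕ) * (q₂ * (Nat.totient (q₁ * r) : ℝ))) := by
      push_cast
      ring
    rw [e1]
    have e2 : ∀ (A Bm : ℝ), ((β n₁ * A : ℝ) : ℂ) - alphaHat M Y * ((β n₁ * Bm : ℝ) : ℂ) =
        (β n₁ : ℂ) * ((A : ℂ) - alphaHat M Y * (Bm : ℂ)) := by
      intro A Bm
      push_cast
      ring
    rw [e2, norm_mul, Complex.norm_real, Real.norm_eq_abs]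
    exact mul_le_mul_of_nonneg_left hB (abs_nonneg _)
  · rw [if_neg h, if_neg h]
    simp only [mul_zero, Complex.ofReal_zero, sub_zero, norm_zero]
    have hT0 : 0 ≤ T := by
      have h1 := htail 1 (Nat.one_mem_divisors.2 hq₂.ne') (by simpa using hV)
      exact le_trans (mul_nonneg (by positivity) (tailBound_nonneg hY _ _ _)) h1
    positivity


/-- `X` with the `n₁`-sum written termwise (the shape produced by `𝒮₂`). [folklore] -/
theorem mainX_eq_sum₄ (a : ℤ) (N Q R : ℝ) (β γ : ℕ → ℝ) :
    mainX a N Q R β γ = ∑ r ∈ dyadic R, ∑ q₁ ∈ dyadic Q, ∑ q₂ ∈ dyadic Q,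
      γ q₁ * γ q₂ * (cSum N β (q₂ * r) / (Nat.totient (q₂ * r) : ℝ)) *
        ∑ n₁ ∈ dyadic N, (if IsCoprime ((q₁ * q₂ * r : ℕ) : ℤ) a ∧ n₁.Coprime (q₁ * r) then
          β n₁ * ((Nat.totient (q₁ * q₂ * r) : ℝ) /
            ((q₁ * q₂ * r : ℕ) * (Nat.totient (q₁ * r) : ℝ))) else 0) := by
  unfold mainX
  refine Finset.sum_congr rfl fun r _ => Finset.sum_congr rfl fun q₁ _ =>
    Finset.sum_congr rfl fun q₂ _ => ?_
  by_cases hka : IsCoprime ((q₁ * q₂ * r : ℕ) : ℤ) a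
  · rw [if_pos hka]
    have e : ∀ n₁ : ℕ, (if IsCoprime ((q₁ * q₂ * r : ℕ) : ℤ) a ∧ n₁.Coprime (q₁ * r) then
        β n₁ * ((Nat.totient (q₁ * q₂ * r) : ℝ) /
          ((q₁ * q₂ * r : ℕ) * (Nat.totient (q₁ * r) : ℝ))) else 0) =
        (if n₁.Coprime (q₁ * r) then β n₁ else 0) *
          ((Nat.totient (q₁ * q₂ * r) : ℝ) / ((q₁ * q₂ * r : ℕ) * (Nat.totient (q₁ * r) : ℝ))) := by
      intro n₁
      by_cases hn : n₁.Coprime (q₁ * r)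
      · rw [if_pos ⟨hka, hn⟩, if_pos hn]
      · rw [if_neg (fun h => hn h.2), if_neg hn, zero_mul]
    simp only [e, ← Finset.sum_mul]
    rw [← cSum]
    have hφ : (Nat.totient (q₁ * r) : ℝ) ≠ 0 ∨ (Nat.totient (q₁ * r) : ℝ) = 0 := ne_or_eq _ _
    rcases hφ with hφ | hφ
    · field_simp
    · simp [hφ]
  · rw [if_neg hka]
    have e : ∀ n₁ : ℕ, (if IsCoprime ((q₁ * q₂ * r : ℕ) : ℤ) a ∧ n₁.Coprime (q₁ * r) then
        β n₁ * ((Nat.totient (q₁ * q₂ * r) : ℝ) /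
          ((q₁ * q₂ * r : ℕ) * (Nat.totient (q₁ * r) : ℝ))) else 0) = 0 := fun n₁ =>
      if_neg (fun h => hka h.1)
    simp only [e, Finset.sum_const_zero, mul_zero]

/-- **`𝒮₂ = f̂(0) X + ℛ₂`** in the range of Theorem 1 (BFI §5, (5.4) p. 218; here the oscillatory
terms `0 < |h| ≤ H₀` of p. 217 are absent because the moduli `ν q₁ r`, `ν ≤ V`, stay below the
length of the smooth variable — in Theorem 1's range `QR < M x^{−3ε}` — so that their Poisson tails
are controlled by the single hypothesis `htail`; the terms `ν > V` are counted trivially as in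
(5.2)): for `0 < Y ≤ M`, `Q, R ≥ 0`, `V ≥ 1`, `j ≥ 2`,
`‖𝒮₂ − α̂₀ X‖ ≤ ∑_{r∼R} ∑_{q₁,q₂∼Q} |γ_{q₁}γ_{q₂}| (∑_{n∼N}|β_n|)² τ(q₂)/φ(q₂r) · (T + (3M+3Y)/(V q₁ r) + 1)`.
[cite: BombieriFriedlanderIwaniecActa1986, §5 (5.1)–(5.4) pp. 216–218] -/
theorem norm_dS2_sub_mainX_le {M Y : ℝ} (hY : 0 < Y) (hYM : Y ≤ M) (a : ℤ) {N Q R : ℝ}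
    (hQ : 0 ≤ Q) (hR : 0 ≤ R) (β γ : ℕ → ℝ) {V T : ℝ} (hV : 1 ≤ V) {j : ℕ} (hj : 2 ≤ j)
    (htail : ∀ q₁ ∈ dyadic Q, ∀ q₂ ∈ dyadic Q, ∀ r ∈ dyadic R, ∀ ν ∈ q₂.divisors, (ν : ℝ) ≤ V →
      ((ν : ℝ) * (q₁ * r : ℕ))⁻¹ * tailBound Y j (ν * (q₁ * r)) 0 ≤ T) :
    ‖(dS2 a (mRange M Y) N Q R (fun m => bump M Y m) β γ : ℂ) -
        alphaHat M Y * (mainX a N Q R β γ : ℂ)‖ ≤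
      ∑ r ∈ dyadic R, ∑ q₁ ∈ dyadic Q, ∑ q₂ ∈ dyadic Q,
        |γ q₁| * |γ q₂| * (∑ n ∈ dyadic N, |β n|) ^ 2 *
          ((σ 0 q₂ : ℝ) / (Nat.totient (q₂ * r) : ℝ)) *
          (T + (3 * M + 3 * Y) / (V * (q₁ * r : ℕ)) + 1) := by
  have hM : 0 ≤ M := hY.le.trans hYM
  have halg : ∀ (U A B : ℂ), U * A - alphaHat M Y * (U * B) = U * (A - alphaHat M Y * B) := by
    intros; ring
  -- per-triple bound
  have key : ∀ r ∈ dyadic R, ∀ q₁ ∈ dyadic Q, ∀ q₂ ∈ dyadic Q,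
      ‖((γ q₁ * γ q₂ * (cSum N β (q₂ * r) / (Nat.totient (q₂ * r) : ℝ)) *
            ∑ n₁ ∈ dyadic N, β n₁ * mA2 a (mRange M Y) (fun m => bump M Y m) r q₁ q₂ n₁ : ℝ) : ℂ) -
        alphaHat M Y * ((γ q₁ * γ q₂ * (cSum N β (q₂ * r) / (Nat.totient (q₂ * r) : ℝ)) *
            ∑ n₁ ∈ dyadic N, (if IsCoprime ((q₁ * q₂ * r : ℕ) : ℤ) a ∧ n₁.Coprime (q₁ * r) then
              β n₁ * ((Nat.totient (q₁ * q₂ * r) : ℝ) /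
                ((q₁ * q₂ * r : ℕ) * (Nat.totient (q₁ * r) : ℝ))) else 0) : ℝ) : ℂ)‖ ≤
        |γ q₁| * |γ q₂| * (∑ n ∈ dyadic N, |β n|) ^ 2 *
          ((σ 0 q₂ : ℝ) / (Nat.totient (q₂ * r) : ℝ)) *
          (T + (3 * M + 3 * Y) / (V * (q₁ * r : ℕ)) + 1) := by
    intro r hr q₁ hq₁ q₂ hq₂
    have hr0 := pos_of_mem_dyadic hR hr
    have hq₁0 := pos_of_mem_dyadic hQ hq₁
    have hq₂0 := pos_of_mem_dyadic hQ hq₂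
    have hφ₂ : (0 : ℝ) < (Nat.totient (q₂ * r) : ℝ) := by
      exact_mod_cast Nat.totient_pos.2 (Nat.mul_pos hq₂0 hr0)
    have hu_le : |γ q₁ * γ q₂ * (cSum N β (q₂ * r) / (Nat.totient (q₂ * r) : ℝ))| ≤
        |γ q₁| * |γ q₂| * ((∑ n ∈ dyadic N, |β n|) / (Nat.totient (q₂ * r) : ℝ)) := by
      rw [abs_mul, abs_mul, abs_div, abs_of_pos hφ₂]
      gcongr
      exact abs_cSum_le N β _
    -- factor the constant `u = γγ c₂/φ₂`
    simp only [Complex.ofReal_mul, Complex.ofReal_sum]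
    rw [halg, norm_mul, ← Complex.ofReal_mul, ← Complex.ofReal_mul, Complex.norm_real,
      Real.norm_eq_abs]
    have hsum : ‖(∑ n₁ ∈ dyadic N,
        ((β n₁ : ℝ) : ℂ) * ((mA2 a (mRange M Y) (fun m => bump M Y m) r q₁ q₂ n₁ : ℝ) : ℂ)) -
          alphaHat M Y * ∑ n₁ ∈ dyadic N,
            ((if IsCoprime ((q₁ * q₂ * r : ℕ) : ℤ) a ∧ n₁.Coprime (q₁ * r) then
              β n₁ * ((Nat.totient (q₁ * q₂ * r) : ℝ) /
                ((q₁ * q₂ * r : ℕ) * (Nat.totient (q₁ * r) : ℝ))) else 0 : ℝ) : ℂ)‖ ≤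
        (∑ n ∈ dyadic N, |β n|) *
          ((σ 0 q₂ : ℝ) * (T + (3 * M + 3 * Y) / (V * (q₁ * r : ℕ)) + 1)) := by
      rw [Finset.mul_sum, ← Finset.sum_sub_distrib]
      refine (norm_sum_le _ _).trans ?_
      rw [Finset.sum_mul]
      refine Finset.sum_le_sum fun n₁ _ => ?_
      rw [← Complex.ofReal_mul]
      exact norm_mA2_term_sub_le hY hYM a hr0 hq₁0 hq₂0 β n₁ hV hj (htail q₁ hq₁ q₂ hq₂ r hr)
    have hS := Finset.sum_nonneg (fun n (_ : n ∈ dyadic N) => abs_nonneg (β n))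
    refine (mul_le_mul hu_le hsum (norm_nonneg _) (by positivity)).trans (le_of_eq ?_)
    rw [sq]
    field_simp
  -- sum over the triples
  rw [dS2_eq, mainX_eq_sum₄, Complex.ofReal_sum, Complex.ofReal_sum, Finset.mul_sum,
    ← Finset.sum_sub_distrib]
  refine (norm_sum_le _ _).trans (Finset.sum_le_sum fun r hr => ?_)
  rw [Complex.ofReal_sum, Complex.ofReal_sum, Finset.mul_sum, ← Finset.sum_sub_distrib]
  refine (norm_sum_le _ _).trans (Finset.sum_le_sum fun q₁ hq₁ => ?_)
  rw [Complex.ofReal_sum, Complex.ofReal_sum, Finset.mul_sum, ← Finset.sum_sub_distrib]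
  refine (norm_sum_le _ _).trans (Finset.sum_le_sum fun q₂ hq₂ => ?_)
  exact key r hr q₁ hq₁ q₂ hq₂

end BFI

end Literature.NumberTheory.Sieve
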